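import Summits.CriticalPhenomena.CardyFormulaZ2.Theorems.CardyWhiteToColouredSimilarityUpgradeC4Bedrock
import Summits.CriticalPhenomena.CardyFormulaZ2.Theorems.CardyWhiteToColouredSimilarityUpgradeStubRectangleFamily

/-!
# Stub `stub_scalingFnDual` (line `registered`, crux `SimilarityUpgrade`, stmt-CriticalPhenomena-4597)

Crux `Summit.CriticalPhenomena.CardyFormulaZ2.Theses.CardyWhiteToColoured.SimilarityUpgrade`,
route `CardyWhiteToColoured`, sub-problem `CardyFormulaZ2`, line `registered`, c5 goal stub
`stub_scalingFnDual`: a documentary consequence of the crux conclusion `X_U`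
(`∃ f, ∀ R, R.HasCrossingLimit (bondDomainCrossingProb R) f`) for the sibling crux
`CardyRigidity` (stmt-CriticalPhenomena-0746).  Every scaling function `f` of a conformally
invariant bond-`ℤ²` crossing limit is **self-dual**: `f η + f (1 - η) = 1` on `(0,1)`, hence
`f (1/2) = 1/2`.

Proof.  From `h : ∀ R, R.HasCrossingLimit (bondDomainCrossingProb R) f` and one uniformizing datum
`(ψ R, y R)` per conformal rectangle (`MarkedDomain.exists_isUniformizing_holds`) we get full
limits `Φ R := f (crossRatio (y R))`.  For `η ∈ (0,1)` take c1's corner-marked box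
`Q w = sh (Q' w)` of modulus `η` (`RectangleFamily.surj`), where `Q' w = rectQuad 0 w 0 1` and
`sh` is the cyclic re-marking by three (`RectangleFamily.exists_shift3`: same carrier, arcs `0/2`
of `Q w` are the arcs `3/1` of `Q' w`).  The modulus of `Q' w` is `1 - η` (`RectangleFamily.flip`)
and the unconditional limit duality of conjugate markings (`limitDuality`, G1 of lead cycle c4,
Schramm–Smirnov Lemma 5.1 for bond-`ℤ²`) gives `Φ (Q' w) + Φ (Q w) = 1`, i.e.
`f (1 - η) + f η = 1`.  At `η = 1/2` this is `f (1/2) = 1/2`.  No definitions are introduced.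

References: O. Schramm, S. Smirnov, Ann. Probab. 39 (2011), Lemma 5.1; B. Bollobás, O. Riordan,
*Percolation* (2006), Ch. 7 §7.1 p. 185; J. Cardy, J. Phys. A 25 (1992) L201.
-/

noncomputable section

namespace Summit.CriticalPhenomena.CardyFormulaZ2.Cruxes.SimilarityUpgrade.Stubs

open Filter Topology Set MeasureTheory
open Literature.Probability.RandomPlanarGeometry
open Literature.Probability.Percolation

/-- **stub_scalingFnDual.** Every scaling function `f` of a conformally invariant bond-`ℤ²`
crossing limit (`∀ R, R.HasCrossingLimit (bondDomainCrossingProb R) f`) is self-dual,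
`f η + f (1 - η) = 1` for `η ∈ (0,1)`, and in particular `f (1/2) = 1/2`: the box of modulus `η`
marked left-to-right and the same box marked bottom-to-top (modulus `1 - η`) have complementary
full limits by the duality of conjugate markings (`limitDuality`).
[cite: SchrammSmirnov2011, Lemma 5.1] -/
theorem stub_scalingFnDual : ∀ f : ℝ → ℝ, (∀ R : ConformalRectangle, R.HasCrossingLimit (bondDomainCrossingProb R) f) → (∀ η ∈ Ioo (0 : ℝ) 1, f η + f (1 - η) = 1) ∧ f (1 / 2) = 1 / 2 := by
  intro f h
  -- one uniformizing datum per conformal rectangle: the full limits `Φ R := f (crossRatio (y R))`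
  choose ψ y hψ using fun R : ConformalRectangle => MarkedDomain.exists_isUniformizing_holds R
  have hlim : ∀ R : ConformalRectangle,
      Tendsto (bondDomainCrossingProb R) (𝓝[>] (0 : ℝ)) (𝓝 (f (crossRatio (y R)))) :=
    fun R => h R (ψ R) (y R) (hψ R)
  -- c1's two families of corner-marked boxes: `Q' w = rectQuad 0 w 0 1`, `Q w = sh (Q' w)`
  choose sh hsh using RectangleFamily.exists_shift3
  obtain ⟨Q', hQ'⟩ : ∃ Q' : ℝ → ConformalRectangle,
      ∀ (w : ℝ) (hw : 0 < w), Q' w = rectQuad 0 w 0 1 hw one_pos :=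
    ⟨fun w => if hw : 0 < w then rectQuad 0 w 0 1 hw one_pos else rectQuad 0 1 0 1 one_pos one_pos,
      fun w hw => dif_pos hw⟩
  have hdual : ∀ η ∈ Ioo (0 : ℝ) 1, f η + f (1 - η) = 1 := by
    intro η hη
    -- a box `Q w` of modulus `η`; the conjugate marking `Q' w` has modulus `1 - η`
    obtain ⟨w, -, hmod⟩ := RectangleFamily.surj sh hsh Q' hQ' η hη
    have hηQ : crossRatio (y (sh (Q' w))) = η := hmod (ψ (sh (Q' w))) (y (sh (Q' w))) (hψ _)
    have hηQ' : crossRatio (y (Q' w)) = 1 - crossRatio (y (sh (Q' w))) :=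
      RectangleFamily.flip sh hsh Q' w (ψ (sh (Q' w))) (y (sh (Q' w))) (ψ (Q' w)) (y (Q' w))
        (hψ _) (hψ _)
    obtain ⟨hc, -, h0, h2, -⟩ := hsh (Q' w)
    -- limit duality of conjugate markings (G1, unconditional)
    have key := limitDuality (fun R => f (crossRatio (y R))) hlim (Q' w) (sh (Q' w)) hc
      (Or.inr ⟨h0, h2⟩)
    rw [hηQ', hηQ] at key
    linarith
  refine ⟨hdual, ?_⟩
  have hhalf := hdual (1 / 2) ⟨by norm_num, by norm_num⟩
  norm_num at hhalf
  linarith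

end Summit.CriticalPhenomena.CardyFormulaZ2.Cruxes.SimilarityUpgrade.Stubs

end
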